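import Mathlib.NumberTheory.LegendreSymbol.JacobiSymbol
import Mathlib.RingTheory.Localization.Integral
import Mathlib.Algebra.Polynomial.Identities
import Mathlib.Algebra.Polynomial.Degree.Domain
import Mathlib.RingTheory.Polynomial.GaussLemma
import Mathlib.FieldTheory.Finite.Basic
import Summits.Parity.BatemanHorn.Theorems.SoloInformedPolynomialGrowth

/-!
# SoloInformedNonResidueClass — an irreducible polynomial has a value that is a quadratic non-residue
# modulo every prime of some unit residue class

Solo unit `solo-Parity-informed` (ideation tier, informed mode), session 14; `PLAN.md` §22.5(a), CLAIMS C61.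

For `g ∈ ℤ[X]` irreducible of degree `≥ 2`:

* `exists_bezout_derivative` — `A g + B g' = R` with `R ∈ ℤ ∖ {0}` (coprimality over `ℚ`, denominators
  cleared);
* `exists_prime_dvd_eval_not_dvd` — for every `N > 0` some prime `ℓ ∤ N` divides some value `g(t)`
  (Schur's argument: `g(cNt) = c (1 + N t (⋯))` with `c = g(0) ≠ 0`);
* `exists_prime_dvd_eval_not_sq_dvd` — hence an odd prime `ℓ` divides some value `g(t₀)` EXACTLY once
  (`ℓ ∤ R ⇒ ℓ ∤ g'(t)`, and `g(t + ℓ) ≡ g(t) + ℓ g'(t) (mod ℓ²)`);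
* `exists_unitClass_jacobiSym_eq_neg_one` — if an odd prime divides `v` exactly once, there is a unit class
  `b₀ (mod 4|v|)` with `J(v | q) = -1` for every prime `q ≡ b₀` (CRT + quadratic reciprocity + periodicity
  of `J(v | ·)` mod `4|v|`);
* `exists_nonsquare_value_unitClass` — the assembled statement: some value `v = g(t₀) ≠ 0` is a quadratic
  non-residue modulo every prime of a unit residue class.  With Dirichlet (`SoloInformedResidueClassMertens`)
  these primes `q` have `∑ 1/q = ∞`; each contributes a local factor `≤ 1 - 1/q` to the sieve for prime-square
  values of `g` (§22.5(a)).
-/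

namespace Summit.Parity.BatemanHorn.Theorems

open Polynomial

/-! ### A unit class of primes for which `v` is a non-residue -/

/-- If an odd prime `ℓ` divides `v` exactly once, then `J(v | q) = -1` for all primes `q` in some unit
class modulo `4|v|`. -/
theorem exists_unitClass_jacobiSym_eq_neg_one {v : ℤ} {ℓ : ℕ} (hℓ : ℓ.Prime) (hℓ2 : ℓ ≠ 2)
    (hdvd : (ℓ : ℤ) ∣ v) (hndvd : ¬ (ℓ : ℤ) ^ 2 ∣ v) :
    ∃ b₀ : ZMod (4 * v.natAbs), IsUnit b₀ ∧
      ∀ q : ℕ, q.Prime → (q : ZMod (4 * v.natAbs)) = b₀ → jacobiSym v q = -1 := by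
  obtain ⟨w, hw⟩ := hdvd
  have hℓw : ¬ (ℓ : ℤ) ∣ w := fun h => hndvd (by rw [hw, sq]; exact mul_dvd_mul_left _ h)
  have hℓodd : Odd ℓ := hℓ.odd_of_ne_two hℓ2
  haveI := Fact.mk hℓ
  -- a non-residue `r mod ℓ`
  obtain ⟨r, hr⟩ := FiniteField.exists_nonsquare (F := ZMod ℓ) (by rw [ZMod.ringChar_zmod_n]; exact hℓ2)
  -- CRT: `b ≡ 1 (mod 4|w|)`, `b ≡ r (mod ℓ)`
  have hcop : Nat.Coprime (4 * w.natAbs) ℓ := by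
    refine Nat.Coprime.mul_left ?_ ?_
    · have h2 : Nat.Coprime 2 ℓ := (Nat.coprime_primes Nat.prime_two hℓ).mpr (Ne.symm hℓ2)
      simpa using h2.pow_left 2
    · rw [Nat.coprime_comm, Nat.Prime.coprime_iff_not_dvd hℓ]
      exact fun h => hℓw (Int.natCast_dvd.mpr h)
  obtain ⟨b, hb1, hb2⟩ := Nat.chineseRemainder hcop 1 r.val
  have hb4 : b % 4 = 1 := by
    have h : b ≡ 1 [MOD 4] := Nat.ModEq.of_mul_right _ hb1
    exact h
  have hb_odd : Odd b := Nat.odd_iff.mpr (by omega)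
  have hbr : (b : ZMod ℓ) = r := by
    rw [(ZMod.natCast_eq_natCast_iff _ _ _).mpr hb2, ZMod.natCast_zmod_val]
  -- `J(w | b) = 1`, `J(ℓ | b) = -1`, so `J(v | b) = -1`
  have hJw : jacobiSym w b = 1 := by
    rw [jacobiSym.mod_right w hb_odd, show b % (4 * w.natAbs) = 1 % (4 * w.natAbs) from hb1,
      ← jacobiSym.mod_right w odd_one, jacobiSym.one_right]
  have hJℓ : jacobiSym ℓ b = -1 := by
    rw [jacobiSym.quadratic_reciprocity_one_mod_four' hℓodd hb4, ← jacobiSym.legendreSym.to_jacobiSym,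
      legendreSym.eq_neg_one_iff', hbr]
    exact hr
  have hJv : jacobiSym v b = -1 := by rw [hw, jacobiSym.mul_left, hJℓ, hJw]; norm_num
  refine ⟨(b : ZMod (4 * v.natAbs)), ?_, fun q hq hqb => ?_⟩
  · -- `b` is a unit mod `4|v|`
    rw [ZMod.isUnit_iff_coprime]
    refine Nat.Coprime.mul_right ?_ ?_
    · simpa using (Nat.coprime_two_right.mpr hb_odd).pow_right 2
    · have h1 : jacobiSym v b ≠ 0 := by rw [hJv]; norm_num
      have h2 : ¬(b ≠ 0 ∧ v.gcd b ≠ 1) := fun h => h1 (jacobiSym.eq_zero_iff.mpr h)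
      push Not at h2
      have h3 : v.gcd b = 1 := h2 (fun h => by simp [h] at hb4)
      rw [Int.gcd_eq_natAbs] at h3
      simpa [Nat.coprime_comm] using h3
  · -- `q ≡ b (mod 4|v|)` ⇒ `J(v | q) = J(v | b)`
    have hqb' : q % (4 * v.natAbs) = b % (4 * v.natAbs) := (ZMod.natCast_eq_natCast_iff' _ _ _).mp hqb
    have hq4 : q % 4 = 1 := by
      have h : q ≡ b [MOD 4] := Nat.ModEq.of_mul_right _ hqb'
      rw [Nat.ModEq, hb4] at h
      exact h
    have hq_odd : Odd q := Nat.odd_iff.mpr (by omega)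
    rw [jacobiSym.mod_right v hq_odd, hqb', ← jacobiSym.mod_right v hb_odd, hJv]

/-! ### Bezout with the derivative -/

/-- For `g ∈ ℤ[X]` irreducible of degree `≥ 2`: `A g + B g' = R` for some nonzero integer `R`. -/
theorem exists_bezout_derivative {g : ℤ[X]} (hirr : Irreducible g) (hdeg : 2 ≤ g.natDegree) :
    ∃ A B : ℤ[X], ∃ R : ℤ, R ≠ 0 ∧ A * g + B * derivative g = C R := by
  set gQ : ℚ[X] := g.map (algebraMap ℤ ℚ) with hgQ
  have hprim : g.IsPrimitive := hirr.isPrimitive (by omega)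
  have hirrQ : Irreducible gQ := (hprim.irreducible_iff_irreducible_map_fraction_map (K := ℚ)).mp hirr
  have hdegQ : gQ.natDegree = g.natDegree := natDegree_map_eq_of_injective (algebraMap ℤ ℚ).injective_int _
  have hd0 : (derivative gQ) ≠ 0 := by
    intro h
    rw [derivative_eq_zero] at h
    omega
  have hndvd : ¬ gQ ∣ derivative gQ :=
    not_dvd_of_natDegree_lt hd0 (natDegree_derivative_lt (by omega))
  obtain ⟨a, b, hab⟩ := (hirrQ.coprime_iff_not_dvd.mpr hndvd)
  -- clear denominators
  obtain ⟨Da, hDa, ha⟩ := IsLocalization.integerNormalization_spec (nonZeroDivisors ℤ) a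
  obtain ⟨Db, hDb, hb⟩ := IsLocalization.integerNormalization_spec (nonZeroDivisors ℤ) b
  set aZ := IsLocalization.integerNormalization (nonZeroDivisors ℤ) a
  set bZ := IsLocalization.integerNormalization (nonZeroDivisors ℤ) b
  have hDa0 : Da ≠ 0 := nonZeroDivisors.ne_zero hDa
  have hDb0 : Db ≠ 0 := nonZeroDivisors.ne_zero hDb
  refine ⟨C Db * aZ, C Da * bZ, Da * Db, mul_ne_zero hDa0 hDb0, ?_⟩
  apply map_injective (algebraMap ℤ ℚ) (algebraMap ℤ ℚ).injective_int
  simp only [Polynomial.map_add, Polynomial.map_mul, map_C, ← derivative_map, ha, hb, ← hgQ]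
  have h1 : C ((algebraMap ℤ ℚ) (Da * Db)) = C ((algebraMap ℤ ℚ) (Da * Db)) * (a * gQ + b * derivative gQ) := by
    rw [hab, mul_one]
  rw [h1]
  simp only [algebraMap_int_eq, eq_intCast, zsmul_eq_mul, map_mul]
  rw [← C_eq_intCast Da, ← C_eq_intCast Db]
  ring

/-! ### Schur: prime divisors of values avoiding a given modulus -/

/-- For `g` irreducible of degree `≥ 2` and `N > 0`, some prime `ℓ ∤ N` divides some value `g(t)`. -/
theorem exists_prime_dvd_eval_not_dvd {g : ℤ[X]} (hirr : Irreducible g) (hdeg : 2 ≤ g.natDegree)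
    {N : ℕ} (hN : 0 < N) : ∃ t : ℤ, ∃ ℓ : ℕ, ℓ.Prime ∧ ¬ ℓ ∣ N ∧ (ℓ : ℤ) ∣ g.eval t := by
  set c : ℤ := g.coeff 0 with hc
  -- `c ≠ 0` since `X ∤ g`
  have hc0 : c ≠ 0 := by
    intro h0
    have hX : X ∣ g := X_dvd_iff.mpr h0
    obtain ⟨h, hh⟩ := hX
    rcases hirr.isUnit_or_isUnit hh with hu | hu
    · exact Polynomial.not_isUnit_X hu
    · have h1 : h.natDegree = 0 := natDegree_eq_zero_of_isUnit hu
      have h2 : g.natDegree ≤ 1 := by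
        rw [hh]
        refine (natDegree_mul_le).trans ?_
        rw [natDegree_X, h1]
      omega
  -- `g = X g₁ + c`, so `g(cNt) = c (1 + N t g₁(cNt))`
  set g₁ : ℤ[X] := g.divX with hg₁
  have hsplit : ∀ t : ℤ, g.eval (c * N * t) = c * (1 + N * (t * g₁.eval (c * N * t))) := by
    intro t
    have h := congrArg (fun p : ℤ[X] => p.eval (c * N * t)) (X_mul_divX_add g)
    simp only [eval_add, eval_mul, eval_X, eval_C] at h
    rw [← hc, ← hg₁] at h
    rw [← h]
    ring
  -- `|g(n)| → ∞`, so some `n = |c| N k` has `|g(n)| > |c|`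
  have hdegR : 0 < (g.map (Int.castRingHom ℝ)).degree := by
    have h1 : (g.map (Int.castRingHom ℝ)).natDegree = g.natDegree :=
      natDegree_map_eq_of_injective Int.cast_injective _
    have h2 : g.map (Int.castRingHom ℝ) ≠ 0 := by
      intro h; rw [h, natDegree_zero] at h1; omega
    rw [degree_eq_natDegree h2]
    exact_mod_cast (show 0 < (g.map (Int.castRingHom ℝ)).natDegree by omega)
  have hmul : Filter.Tendsto (fun k : ℕ => c.natAbs * N * k) Filter.atTop Filter.atTop := by
    refine Filter.tendsto_atTop_mono (fun k => ?_) Filter.tendsto_id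
    have : 1 ≤ c.natAbs * N := Nat.one_le_iff_ne_zero.mpr (mul_ne_zero (Int.natAbs_ne_zero.mpr hc0) hN.ne')
    calc k = 1 * k := (one_mul k).symm
      _ ≤ c.natAbs * N * k := Nat.mul_le_mul_right k this
  have htend := ((Polynomial.abs_tendsto_atTop _ hdegR).comp tendsto_natCast_atTop_atTop).comp hmul
  obtain ⟨k, hk⟩ := (htend.eventually_gt_atTop (|(c : ℝ)|)).exists
  simp only [Function.comp_apply, eval_natCast_map_intCast] at hk
  -- `n = c N t` with `t = sign c · k`
  set t : ℤ := Int.sign c * k with ht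
  have hn : ((c.natAbs * N * k : ℕ) : ℤ) = c * N * t := by
    rw [ht]; push_cast
    rw [← Int.sign_mul_self_eq_abs]
    ring
  have hbig : |c| < |g.eval (c * N * t)| := by
    rw [← hn]
    have : |((c : ℤ) : ℝ)| < |((g.eval ((c.natAbs * N * k : ℕ) : ℤ) : ℤ) : ℝ)| := hk
    rw [← Int.cast_abs, ← Int.cast_abs] at this
    exact_mod_cast this
  -- `u = 1 + N t g₁(cNt)` has `|u| ≥ 2`; take a prime factor `ℓ` of `u`
  set u : ℤ := 1 + N * (t * g₁.eval (c * N * t)) with hu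
  have hgu : g.eval (c * N * t) = c * u := hsplit t
  have hu1 : u.natAbs ≠ 1 := by
    intro h1
    rw [hgu, abs_mul] at hbig
    have : |u| = 1 := by
      rw [Int.abs_eq_natAbs, h1]; rfl
    rw [this, mul_one] at hbig
    exact lt_irrefl _ hbig
  obtain ⟨ℓ, hℓ, hℓu⟩ := Nat.exists_prime_and_dvd hu1
  refine ⟨c * N * t, ℓ, hℓ, fun hℓN => ?_, ?_⟩
  · -- `ℓ ∣ N` and `ℓ ∣ u = 1 + N(⋯)` give `ℓ ∣ 1`
    have h1 : (ℓ : ℤ) ∣ u := Int.natCast_dvd.mpr hℓu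
    have h2 : (ℓ : ℤ) ∣ N * (t * g₁.eval (c * N * t)) :=
      (Int.natCast_dvd_natCast.mpr hℓN).mul_right _
    have h3 : (ℓ : ℤ) ∣ 1 := by
      have := h1
      rw [hu] at this
      exact (dvd_add_left h2).mp this
    exact hℓ.one_lt.ne' (by exact_mod_cast Int.eq_one_of_dvd_one (by positivity) h3)
  · rw [hgu]
    exact (Int.natCast_dvd.mpr hℓu).mul_left c

/-! ### An odd prime dividing a value exactly once -/

/-- For `g` irreducible of degree `≥ 2`, some odd prime divides some value `g(t₀)` exactly once. -/
theorem exists_prime_dvd_eval_not_sq_dvd {g : ℤ[X]} (hirr : Irreducible g) (hdeg : 2 ≤ g.natDegree) :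
    ∃ t₀ : ℤ, ∃ ℓ : ℕ, ℓ.Prime ∧ ℓ ≠ 2 ∧ (ℓ : ℤ) ∣ g.eval t₀ ∧ ¬ (ℓ : ℤ) ^ 2 ∣ g.eval t₀ :=
  by
  obtain ⟨A, B, R, hR0, hAB⟩ := exists_bezout_derivative hirr hdeg
  obtain ⟨t, ℓ, hℓ, hℓN, hℓt⟩ :=
    exists_prime_dvd_eval_not_dvd hirr hdeg (N := 2 * R.natAbs) (by positivity)
  have hℓ2 : ℓ ≠ 2 := by rintro rfl; exact hℓN (dvd_mul_right 2 _)
  have hℓR : ¬ (ℓ : ℤ) ∣ R := fun h => hℓN (Dvd.dvd.mul_left (Int.natCast_dvd.mp h) 2)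
  -- `ℓ ∤ g'(t)`, from `A(t) g(t) + B(t) g'(t) = R`
  have hℓd : ¬ (ℓ : ℤ) ∣ (derivative g).eval t := by
    intro h
    apply hℓR
    have h1 := congrArg (fun p : ℤ[X] => p.eval t) hAB
    simp only [eval_add, eval_mul, eval_C] at h1
    rw [← h1]
    exact dvd_add (hℓt.mul_left _) (h.mul_left _)
  by_cases hsq : (ℓ : ℤ) ^ 2 ∣ g.eval t
  · -- move to `t + ℓ`: `g(t + ℓ) = g(t) + g'(t) ℓ + k ℓ²`
    obtain ⟨k, hk⟩ := Polynomial.binomExpansion g t (ℓ : ℤ)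
    refine ⟨t + ℓ, ℓ, hℓ, hℓ2, ?_, fun h2 => hℓd ?_⟩
    · rw [hk]
      exact dvd_add (dvd_add hℓt (dvd_mul_left _ _)) (Dvd.intro_left (k * ℓ) (by ring))
    · -- `ℓ² ∣ g(t+ℓ)` and `ℓ² ∣ g(t)`, `ℓ² ∣ k ℓ²` ⇒ `ℓ² ∣ g'(t) ℓ` ⇒ `ℓ ∣ g'(t)`
      rw [hk] at h2
      have h3 : (ℓ : ℤ) ^ 2 ∣ (derivative g).eval t * ℓ := by
        have h4 : (ℓ : ℤ) ^ 2 ∣ k * (ℓ : ℤ) ^ 2 := dvd_mul_left _ _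
        have := (dvd_add_right hsq).mp ((dvd_add_left h4).mp h2)
        exact this
      rw [sq] at h3
      exact (mul_dvd_mul_iff_right (by exact_mod_cast hℓ.ne_zero)).mp h3
  · exact ⟨t, ℓ, hℓ, hℓ2, hℓt, hsq⟩

/-! ### Assembly -/

/-- **Some value of an irreducible polynomial of degree `≥ 2` is a quadratic non-residue modulo every prime of
a unit residue class.** -/
theorem exists_nonsquare_value_unitClass {g : ℤ[X]} (hirr : Irreducible g) (hdeg : 2 ≤ g.natDegree) :
    ∃ t₀ : ℤ, g.eval t₀ ≠ 0 ∧ ∃ M : ℕ, 0 < M ∧ ∃ b₀ : ZMod M, IsUnit b₀ ∧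
      ∀ q : ℕ, q.Prime → (q : ZMod M) = b₀ → ¬ IsSquare ((g.eval t₀ : ℤ) : ZMod q) := by
  obtain ⟨t₀, ℓ, hℓ, hℓ2, hdvd, hndvd⟩ := exists_prime_dvd_eval_not_sq_dvd hirr hdeg
  have hv0 : g.eval t₀ ≠ 0 := by rintro h; rw [h] at hndvd; exact hndvd (dvd_zero _)
  obtain ⟨b₀, hb₀, hq⟩ := exists_unitClass_jacobiSym_eq_neg_one hℓ hℓ2 hdvd hndvd
  refine ⟨t₀, hv0, 4 * (g.eval t₀).natAbs, by positivity [Int.natAbs_pos.mpr hv0], b₀, hb₀,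
    fun q hqp hqb => ?_⟩
  haveI := Fact.mk hqp
  rw [← legendreSym.eq_neg_one_iff, jacobiSym.legendreSym.to_jacobiSym]
  exact hq q hqp hqb

end Summit.Parity.BatemanHorn.Theorems
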